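import Summits.AtomisticToContinuum.Crystallization.Theorems.OverbindingBudgetAffineFarFieldCollar

/-!
# Overbinding budget — far-field Voronoi cells, part 27V-T «CollarKit»: generic tools for T0′ and T4

Route `OverbindingBudget`, crux `RobustDefectLimitWindows` (stmt-31280), line (2c), leaf SW♭(30),
part 27V-T.  «Collar» (206) typed the tube lemmas T0/T2/T3/T5 over the ACTUAL Voronoi tessellation
`K₁ q = voronoiCell Y q` of the atom set and used of the REFERENCE cells `K₂` only their cover.  The
two convention-bound items that remain — (T0′) the reference cells ARE the moved ideal cells and
cover space, (T4) each actual collar facet `K_q ∩ K_q'` sits in an explicit prism of known volume —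
rest on the generic, atlas-free facts of this file:
* §1 (towards T0′) FAR ATOMS ARE REDUNDANT: if the cell cut out by a sub-family `S ⊆ Z` lies in
  `closedBall z r` and every other atom is at distance `≥ 2r` from `z`, then `voronoiCell Z z` is the
  cell cut out by `S` (`voronoiCell_eq_of_far`; for a Barlow stacking `S` = the twelve touching
  neighbours, `r` = the circumradius `ν/√2` of the rd/trd cell, second distance `√2·ν = 2r`);
  SIMILARITIES MAP CELLS TO CELLS (`image_voronoiCell_of_dist_eq`, for the move `x ↦ y + ν R x`);
  a UNIFORMLY DISCRETE set is locally finite (`finite_inter_closedBall_of_le_dist`, the hypothesis `hZ`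
  of (206), by ball packing and volume).
* §2 (towards T4) thickenings and charts: `cthickening u` of a chart image lies in the chart image of
  `cthickening (u/a)` (`cthickening_image_subset`, `a` the chart's lower row); the `u`-thickening of a
  convex body containing `closedBall c ρ` lies in its `(1 + u/ρ)`-homothet about `c`
  (`cthickening_subset_homothety`); a NEARBY chart's image of a convex body `closedBall 0 ρ ⊆ X ⊆
  closedBall 0 r`, shifted by `d`, lies in the reference chart's image of the `(1 + (Δr + η)/(aρ))`-
  homothet (`image_subset_homothety_of_near` — the neighbour's outer cell seen in the site's own
  chart); an inflated cell cut by a half-space is the inflated CAP (`smul_inter_halfspace`); THE LENS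
  `inter_subset_image_cap`: the site's and the neighbour's outer cells meet inside the chart image of
  the inflated cap of the site's ideal cell at the ideal facet; thickened boxes are boxes
  (`cthickening_coordBox_subset`).
* §3 (T4 volume) the volume of the chart image of a coordinate box is `|det T|·∏ (h i − l i)`
  (`volume_image_box`: prism = facet parallelogram × normal interval in the facet frame `T`).
-/

namespace Summit.AtomisticToContinuum.Crystallization.Theorems.OverbindingBudgetAffineFarFieldCollarKit

noncomputable section

open Set MeasureTheory Metric
open Literature.Barriers.AtomisticToContinuum (voronoiCell)

local notation "E3" => EuclideanSpace ℝ (Fin 3)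

/-! ## §1 Redundancy, similarity equivariance, local finiteness -/

/-- T0′ (generic half): atoms at distance `≥ 2r` from `z` do not cut the cell of `z` if the cell cut
out by the sub-family `S ⊆ Z` already lies in `closedBall z r`. -/
theorem voronoiCell_eq_of_far {Z S : Set E3} {z : E3} {r : ℝ} (hS : S ⊆ Z)
    (hr : ∀ x, (∀ v ∈ S, dist x z ≤ dist x v) → dist x z ≤ r)
    (hfar : ∀ w ∈ Z, w ∉ S → w ≠ z → 2 * r ≤ dist w z) :
    voronoiCell Z z = {x | ∀ v ∈ S, dist x z ≤ dist x v} := by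
  ext x
  refine ⟨fun hx v hv => hx v (hS hv), fun hx w hw => ?_⟩
  by_cases hwS : w ∈ S
  · exact hx w hwS
  by_cases hwz : w = z
  · rw [hwz]
  have h1 := hr x hx
  have h2 := hfar w hw hwS hwz
  have h3 := dist_triangle w x z
  rw [dist_comm w x] at h3
  linarith

/-- T0′ (generic half): a similarity `f` (`dist (f x) (f y) = λ·dist x y`, `λ > 0`, onto) maps the
Voronoi cell of `z` in `Z` onto the Voronoi cell of `f z` in `f '' Z` — for the move
`x ↦ y + ν·R x` of the ideal stacking this says: reference cell = moved ideal cell. -/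
theorem image_voronoiCell_of_dist_eq {Z : Set E3} {z : E3} (f : E3 → E3) {lam : ℝ} (hlam : 0 < lam)
    (hf : ∀ x y, dist (f x) (f y) = lam * dist x y) (hsurj : Function.Surjective f) :
    f '' voronoiCell Z z = voronoiCell (f '' Z) (f z) := by
  ext p
  constructor
  · rintro ⟨x, hx, rfl⟩ w' ⟨w, hw, rfl⟩
    rw [hf, hf]
    exact mul_le_mul_of_nonneg_left (hx w hw) hlam.le
  · intro hp
    obtain ⟨x, rfl⟩ := hsurj p
    refine ⟨x, fun w hw => ?_, rfl⟩
    have h := hp (f w) ⟨w, hw, rfl⟩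
    rw [hf, hf] at h
    exact le_of_mul_le_mul_left h hlam

/-- T0′ / hypothesis `hZ` of (206): a uniformly discrete set (distinct points at distance `≥ δ > 0`)
meets every closed ball in a finite set — the balls `ball x (δ/2)` about its points are disjoint,
congruent and packed into `ball p (r + δ)`, whose volume is finite.  (Folklore; proved here by volume
to keep the import cone at (206) — cf. `Literature.MathematicalPhysics.StatisticalMechanics.
finite_of_forall_le_dist_of_subset_closedBall`, by accumulation points, not imported.) -/
theorem finite_inter_closedBall_of_le_dist {Z : Set E3} {δ : ℝ} (hδ : 0 < δ)
    (hsep : ∀ x ∈ Z, ∀ y ∈ Z, x ≠ y → δ ≤ dist x y) (p : E3) (r : ℝ) :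
    (Z ∩ closedBall p r).Finite := by
  by_contra hinf
  have hinf' : (Z ∩ closedBall p r).Infinite := hinf
  have hv0 : volume (ball (0 : E3) (δ / 2)) ≠ 0 := (measure_ball_pos volume _ (by linarith)).ne'
  have hV : volume (ball p (r + δ)) ≠ ⊤ := measure_ball_lt_top.ne
  obtain ⟨n, hn⟩ := ENNReal.exists_nat_mul_gt hv0 hV
  obtain ⟨T, hTZ, hTc⟩ := hinf'.exists_subset_card_eq n
  have hdisj : (↑T : Set E3).PairwiseDisjoint fun x => ball x (δ / 2) := by
    intro x hx y hy hxy
    refine Set.disjoint_left.2 fun q hqx hqy => ?_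
    have h1 : dist q x < δ / 2 := mem_ball.1 hqx
    have h2 : dist q y < δ / 2 := mem_ball.1 hqy
    have h3 := hsep x (hTZ hx).1 y (hTZ hy).1 hxy
    have h4 := dist_triangle_left x y q
    linarith
  have hsub : (⋃ x ∈ T, ball x (δ / 2)) ⊆ ball p (r + δ) := by
    intro q hq
    simp only [mem_iUnion, exists_prop] at hq
    obtain ⟨x, hx, hqx⟩ := hq
    have h1 : dist x p ≤ r := mem_closedBall.1 (hTZ hx).2
    have h2 : dist q x < δ / 2 := mem_ball.1 hqx
    exact mem_ball.2 (by linarith [dist_triangle q x p])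
  have hmeas : volume (⋃ x ∈ T, ball x (δ / 2)) = n * volume (ball (0 : E3) (δ / 2)) := by
    rw [measure_biUnion_finset hdisj fun x _ => measurableSet_ball]
    simp_rw [Measure.addHaar_ball_center volume]
    rw [Finset.sum_const, hTc, nsmul_eq_mul]
  have := measure_mono (μ := volume) hsub
  rw [hmeas] at this
  exact absurd (hn.trans_le this) (lt_irrefl _)

/-! ## §2 Thickenings, homothets and nearby charts -/

/-- T4 (generic): the `u`-thickening of a chart image `y + A '' S` (`S` compact) lies in the chart
image of the `u/a`-thickening, `a > 0` the chart's lower row `a‖v‖ ≤ ‖A v‖`. -/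
theorem cthickening_image_subset (A : E3 →L[ℝ] E3) (y : E3) {a : ℝ} (ha : 0 < a)
    (hlow : ∀ v, a * ‖v‖ ≤ ‖A v‖) (hsurj : Function.Surjective A) {S : Set E3} (hS : IsCompact S)
    {u : ℝ} (hu : 0 ≤ u) :
    cthickening u ((fun x => y + A x) '' S) ⊆ (fun x => y + A x) '' cthickening (u / a) S := by
  have hc : IsCompact ((fun x => y + A x) '' S) := hS.image (by fun_prop)
  rw [hc.cthickening_eq_biUnion_closedBall hu]
  intro x hx
  simp only [mem_iUnion, exists_prop] at hx
  obtain ⟨x₁, ⟨s, hs, rfl⟩, hx⟩ := hx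
  obtain ⟨e, he⟩ := hsurj (x - (y + A s))
  refine ⟨s + e, ?_, ?_⟩
  · refine mem_cthickening_of_dist_le (s + e) s (u / a) S hs ?_
    rw [dist_eq_norm, add_sub_cancel_left, le_div_iff₀ ha, mul_comm]
    refine (hlow e).trans ?_
    rw [he, ← dist_eq_norm]
    exact mem_closedBall.1 hx
  · simp only [map_add, he]; abel

/-- T4 (generic): the `u`-thickening of a compact convex body containing `closedBall c ρ` lies in its
`(1 + u/ρ)`-homothet about `c`. -/
theorem cthickening_subset_homothety {X : Set E3} (hXc : Convex ℝ X) (hX : IsCompact X) {c : E3}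
    {ρ u : ℝ} (hρ : 0 < ρ) (hu : 0 ≤ u) (hball : closedBall c ρ ⊆ X) :
    cthickening u X ⊆ (fun x => c + (1 + u / ρ) • (x - c)) '' X := by
  rw [hX.cthickening_eq_biUnion_closedBall hu]
  intro x hx
  simp only [mem_iUnion, exists_prop] at hx
  obtain ⟨x₁, hx₁, hx⟩ := hx
  set t : ℝ := u / ρ with ht
  have ht0 : 0 ≤ t := div_nonneg hu hρ.le
  -- the point `w := c + (ρ/u)(x − x₁)` of the ball (if `u > 0`), and the convex combination
  rcases eq_or_lt_of_le hu with hu0 | hu'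
  · refine ⟨x₁, hx₁, ?_⟩
    have : x = x₁ := by
      have h := mem_closedBall.1 hx; rw [← hu0] at h; exact (dist_le_zero.1 h)
    show c + (1 + t) • (x₁ - c) = x
    rw [this, ht, ← hu0, zero_div, add_zero, one_smul, add_sub_cancel]
  have htpos : 0 < t := div_pos hu' hρ
  have htne : t ≠ 0 := htpos.ne'
  set w : E3 := c + t⁻¹ • (x - x₁) with hw
  have hwX : w ∈ X := by
    refine hball (mem_closedBall.2 ?_)
    rw [hw, dist_eq_norm, add_sub_cancel_left, norm_smul, Real.norm_eq_abs, abs_of_pos (inv_pos.2 htpos),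
      ht, inv_div, ← dist_eq_norm, div_mul_eq_mul_div, div_le_iff₀ hu']
    exact mul_le_mul_of_nonneg_left (mem_closedBall.1 hx) hρ.le
  -- `z := (1/(1+t)) x₁ + (t/(1+t)) w = c + (1+t)⁻¹ (x − c) ∈ X` and `x = c + (1+t)(z − c)`
  have h1t : 0 < 1 + t := by linarith
  have h1t' : 1 + t ≠ 0 := h1t.ne'
  have k1 : t * (1 + t)⁻¹ * t⁻¹ = (1 + t)⁻¹ := by field_simp
  have k2 : t * (1 + t)⁻¹ = 1 - (1 + t)⁻¹ := by field_simp; ring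
  have hz : (1 + t)⁻¹ • x₁ + (t * (1 + t)⁻¹) • w = c + (1 + t)⁻¹ • (x - c) := by
    rw [hw, smul_add, smul_smul, k1, k2, smul_sub, smul_sub, sub_smul, one_smul]; abel
  refine ⟨c + (1 + t)⁻¹ • (x - c), ?_, ?_⟩
  · rw [← hz]
    exact hXc hx₁ hwX (inv_pos.2 h1t).le (mul_nonneg ht0 (inv_pos.2 h1t).le) (by field_simp)
  · show c + (1 + t) • (c + (1 + t)⁻¹ • (x - c) - c) = x
    rw [add_sub_cancel_left, smul_smul, mul_inv_cancel₀ h1t', one_smul, add_sub_cancel]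

/-- T4 (generic): THE NEIGHBOUR'S OUTER CELL IN THE SITE'S OWN CHART.  `X` convex with
`closedBall 0 ρ ⊆ X ⊆ closedBall 0 r`, charts `A, A'` with `‖A' − A‖ ≤ Δ`, `A` onto with a right
inverse of norm `≤ a⁻¹`, and a shift `‖d‖ ≤ η`: then `A' '' X + d ⊆ A '' ((1 + (Δr + η)/(aρ)) • X)`. -/
theorem image_subset_homothety_of_near (A A' Ai : E3 →L[ℝ] E3) {X : Set E3} (hXc : Convex ℝ X)
    {ρ r Δ η a : ℝ} (hρ : 0 < ρ) (ha : 0 < a) (hball : closedBall 0 ρ ⊆ X) (hXr : X ⊆ closedBall 0 r)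
    (hΔ : ‖A' - A‖ ≤ Δ) (hAi : ∀ v, A (Ai v) = v) (hAi' : ∀ v, ‖Ai v‖ ≤ a⁻¹ * ‖v‖) {d : E3}
    (hd : ‖d‖ ≤ η) :
    (fun x => A' x + d) '' X ⊆ A '' ((fun x => (1 + (Δ * r + η) / (a * ρ)) • x) '' X) := by
  rintro _ ⟨x, hx, rfl⟩
  have hr : 0 ≤ r := by
    have h := hXr (hball (mem_closedBall_self hρ.le)); rw [mem_closedBall, dist_self] at h; exact h
  have hΔ0 : 0 ≤ Δ := (norm_nonneg _).trans hΔ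
  have hη0 : 0 ≤ η := (norm_nonneg _).trans hd
  set t : ℝ := (Δ * r + η) / (a * ρ) with ht
  have ht0 : 0 ≤ t := div_nonneg (by positivity) (by positivity)
  -- the error vector, pulled back
  set e : E3 := Ai ((A' - A) x + d) with he
  have hAe : A e = (A' - A) x + d := hAi _
  have hxe : A' x + d = A (x + e) := by
    rw [map_add, hAe, show (A' - A) x = A' x - A x from rfl]; abel
  have hen : ‖e‖ ≤ t * ρ := by
    have hx' : ‖x‖ ≤ r := by simpa [mem_closedBall, dist_zero_right] using hXr hx
    calc ‖e‖ ≤ a⁻¹ * ‖(A' - A) x + d‖ := hAi' _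
      _ ≤ a⁻¹ * (Δ * r + η) := by
          refine mul_le_mul_of_nonneg_left ((norm_add_le _ _).trans (add_le_add ?_ hd)) (inv_pos.2 ha).le
          exact ((A' - A).le_opNorm x).trans (mul_le_mul hΔ hx' (norm_nonneg _) hΔ0)
      _ = t * ρ := by rw [ht]; field_simp
  refine ⟨x + e, ?_, hxe.symm⟩
  -- `x + e ∈ (1+t) • X` by convexity: `x + e = (1+t) • ((1/(1+t)) x + (t/(1+t)) (e/t))`
  rcases eq_or_lt_of_le ht0 with ht00 | htpos
  · have he0 : e = 0 := by
      have : ‖e‖ ≤ 0 := by rw [← ht00, zero_mul] at hen; exact hen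
      exact norm_le_zero_iff.1 this
    refine ⟨x, hx, ?_⟩
    show (1 + t) • x = x + e
    rw [he0, add_zero, ← ht00, add_zero, one_smul]
  have h1t : 0 < 1 + t := by linarith
  have h1t' : 1 + t ≠ 0 := h1t.ne'
  have htne : t ≠ 0 := htpos.ne'
  have hwX : t⁻¹ • e ∈ X := by
    refine hball (mem_closedBall.2 ?_)
    rw [dist_zero_right, norm_smul, Real.norm_eq_abs, abs_of_pos (inv_pos.2 htpos), inv_mul_le_iff₀ htpos]
    exact hen
  refine ⟨(1 + t)⁻¹ • x + (t * (1 + t)⁻¹) • (t⁻¹ • e), hXc hx hwX (inv_pos.2 h1t).le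
    (mul_nonneg ht0 (inv_pos.2 h1t).le) (by field_simp), ?_⟩
  show (1 + t) • ((1 + t)⁻¹ • x + (t * (1 + t)⁻¹) • (t⁻¹ • e)) = x + e
  rw [smul_add, smul_smul, smul_smul, smul_smul, mul_inv_cancel₀ h1t',
    show (1 + t) * (t * (1 + t)⁻¹) * t⁻¹ = 1 by field_simp, one_smul, one_smul]

/-- T4 (generic): an inflated convex cell cut by a half-space is the inflated cap —
`(λ • K) ∩ {β ≤ ⟪x, n⟫} = λ • (K ∩ {β/λ ≤ ⟪x, n⟫})` for `λ > 0`. -/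
theorem smul_inter_halfspace (K : Set E3) (n : E3) {lam β : ℝ} (hlam : 0 < lam) :
    (fun x => lam • x) '' K ∩ {x | β ≤ inner ℝ x n} =
      (fun x => lam • x) '' (K ∩ {x | β / lam ≤ inner ℝ x n}) := by
  ext x
  simp only [mem_inter_iff, mem_image, mem_setOf_eq]
  constructor
  · rintro ⟨⟨k, hk, rfl⟩, hβ⟩
    refine ⟨k, ⟨hk, ?_⟩, rfl⟩
    rw [inner_smul_left, RCLike.conj_to_real] at hβ
    rwa [div_le_iff₀' hlam]
  · rintro ⟨k, ⟨hk, hβ⟩, rfl⟩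
    refine ⟨⟨k, hk, rfl⟩, ?_⟩
    rw [inner_smul_left, RCLike.conj_to_real]
    rwa [div_le_iff₀' hlam] at hβ

/-- T4 (generic): THE LENS.  The site's inflated cell `y + A (λ•K)` and the neighbour's cell written
in the site's chart as `y + A (v + λ'•K')` (`v` the ideal bond; `image_subset_homothety_of_near`
puts it in this form), with `K'` beyond the bisector of `−v` (`−‖v‖²/2 ≤ ⟪x, v⟫` on `K'`), meet
inside the image of the inflated CAP `λ • (K ∩ {‖v‖²(1 − λ'/2)/λ ≤ ⟪x, v⟫})` of the site's cell. -/
theorem inter_subset_image_cap (A : E3 →L[ℝ] E3) (hA : Function.Injective A) (y v : E3)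
    {K K' : Set E3} {lam lam' : ℝ} (hlam : 0 < lam) (hlam' : 0 ≤ lam')
    (hK' : K' ⊆ {x | -(‖v‖ ^ 2 / 2) ≤ inner ℝ x v}) :
    (fun x => y + A x) '' ((fun x => lam • x) '' K) ∩
        (fun x => y + A x) '' ((fun x => v + x) '' ((fun x => lam' • x) '' K')) ⊆
      (fun x => y + A x) ''
        ((fun x => lam • x) '' (K ∩ {x | ‖v‖ ^ 2 * (1 - lam' / 2) / lam ≤ inner ℝ x v})) := by
  rintro p ⟨⟨x₁, hx₁, rfl⟩, ⟨x₂, ⟨x₃, ⟨k', hk', rfl⟩, rfl⟩, hp⟩⟩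
  have h12 : v + lam' • k' = x₁ := hA (add_left_cancel hp)
  refine ⟨x₁, ?_, rfl⟩
  rw [← smul_inter_halfspace K v hlam]
  refine ⟨hx₁, ?_⟩
  show ‖v‖ ^ 2 * (1 - lam' / 2) ≤ inner ℝ x₁ v
  rw [← h12, inner_add_left, real_inner_self_eq_norm_sq, inner_smul_left, RCLike.conj_to_real]
  have hk := hK' hk'
  simp only [mem_setOf_eq] at hk
  nlinarith [mul_le_mul_of_nonneg_left hk hlam']

/-- T4 (generic): the `δ`-thickening of the coordinate box `{l ≤ x ≤ h}` lies in the box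
`{l − δ ≤ x ≤ h + δ}` (each coordinate is `1`-Lipschitz). -/
theorem cthickening_coordBox_subset (l h : Fin 3 → ℝ) {δ : ℝ} (hδ : 0 ≤ δ) :
    cthickening δ {x : E3 | ∀ i, l i ≤ x i ∧ x i ≤ h i} ⊆
      {x : E3 | ∀ i, l i - δ ≤ x i ∧ x i ≤ h i + δ} := by
  have hcl : IsClosed {x : E3 | ∀ i, l i ≤ x i ∧ x i ≤ h i} := by
    have : {x : E3 | ∀ i, l i ≤ x i ∧ x i ≤ h i} = ⋂ i, ({x : E3 | l i ≤ x i} ∩ {x | x i ≤ h i}) := by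
      ext x; simp
    rw [this]
    exact isClosed_iInter fun i =>
      (isClosed_le continuous_const (EuclideanSpace.proj i).continuous).inter
        (isClosed_le (EuclideanSpace.proj i).continuous continuous_const)
  rw [hcl.cthickening_eq_biUnion_closedBall hδ]
  intro x hx i
  simp only [mem_iUnion, exists_prop] at hx
  obtain ⟨z, hz, hxz⟩ := hx
  have h1 : |x i - z i| ≤ δ := by
    have h := PiLp.norm_apply_le (x - z) i
    rw [PiLp.sub_apply, Real.norm_eq_abs, ← dist_eq_norm] at h
    exact h.trans (mem_closedBall.1 hxz)
  have h2 := hz i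
  rw [abs_le] at h1
  constructor <;> linarith [h1.1, h1.2, h2.1, h2.2]

/-! ## §3 The prism volume -/

/-- T4 (volume): the chart image `y + T '' B` of the coordinate box `B = {x | ∀ i, l i ≤ x i ≤ h i}`
(`l ≤ h`) has volume `|det T| · ∏ i, (h i − l i)` — with `T = [e₁ e₂ n]` the facet frame (edge
vectors of the facet parallelogram and the unit normal) this is the prism `2u·λ²·A_F`. -/
theorem volume_image_box (T : E3 →L[ℝ] E3) (y : E3) (l h : Fin 3 → ℝ) (hlh : ∀ i, l i ≤ h i) :
    (volume ((fun x => y + T x) '' {x : E3 | ∀ i, l i ≤ x i ∧ x i ≤ h i})).toReal =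
      |T.det| * ∏ i, (h i - l i) := by
  have hbox : {x : E3 | ∀ i, l i ≤ x i ∧ x i ≤ h i} = (WithLp.ofLp : E3 → (Fin 3 → ℝ)) ⁻¹' Icc l h := by
    ext x
    simp only [mem_setOf_eq, mem_preimage, mem_Icc, Pi.le_def]
    exact ⟨fun H => ⟨fun i => (H i).1, fun i => (H i).2⟩, fun H i => ⟨H.1 i, H.2 i⟩⟩
  have hvolB : volume {x : E3 | ∀ i, l i ≤ x i ∧ x i ≤ h i} = ∏ i, ENNReal.ofReal (h i - l i) := by
    rw [hbox, (PiLp.volume_preserving_ofLp (Fin 3)).measure_preimage measurableSet_Icc.nullMeasurableSet,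
      Real.volume_Icc_pi]
  have himg : (fun x => y + T x) '' {x : E3 | ∀ i, l i ≤ x i ∧ x i ≤ h i} =
      (fun z => -y + z) ⁻¹' (T '' {x : E3 | ∀ i, l i ≤ x i ∧ x i ≤ h i}) := by
    rw [← image_add_left, image_image]
  rw [himg, measure_preimage_add, Measure.addHaar_image_continuousLinearMap, hvolB,
    ENNReal.toReal_mul, ENNReal.toReal_ofReal (abs_nonneg _), ENNReal.toReal_prod]
  congr 1
  exact Finset.prod_congr rfl fun i _ => ENNReal.toReal_ofReal (sub_nonneg.2 (hlh i))

end

end Summit.AtomisticToContinuum.Crystallization.Theorems.OverbindingBudgetAffineFarFieldCollarKit
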